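import Summits.Schanuel.Schanuel.Theorems.DiophantineDichotomyKhovanskiiApproxTypeEvDefs
import Summits.Schanuel.Schanuel.Theorems.DiophantineDichotomyApproximationRaceEv
import Summits.Schanuel.Schanuel.Theorems.DiophantineDichotomyApproximationPropertyDegOne
import HarnessLib

/-!
# Route `DiophantineDichotomy`, crux `KhovanskiiApproxTypeEv`, line `anchored-reduction`:
# unconditional hardness certificates of the two open stubs (level-one race)

Crux `Summit.Schanuel.Schanuel.Theses.DiophantineDichotomy.KhovanskiiApproxTypeEv`
(item stmt-Schanuel-14972), line `anchored-reduction` (skeleton `Cruxes/KhovanskiiApproxTypeEv/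
Lines/Sketch.lean`, v5, leads `prover-line-stmt-Schanuel-14972-0`, `…-c1-0`, `…-c2-0`, `…-c3-0`).
The skeleton concludes the crux by name from exactly two sorries, the registered stubs
`stub_evNonLW_two : EvNonLWTwo` and `stub_evRankThreeUp : EvRankThreeUp`.  This file certifies,
UNCONDITIONALLY and uniformly, that each of them is open-problem grade: an eventual approximation
type with degree exponent `a < 1` at ANY point `θ = (s, e^s)`, `s ≠ 0`, already forces
`trdeg_ℚ ℚ(s, e^s) ≥ 2`, because the level-one approximation property
(`ApproximationPropertyDegOne`, PROVED in the tree: `approximationPropertyDegOne_proof`, Diaz 1997 =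
Bugeaud 2004 Thm 8.11 + Roy–Waldschmidt lifting) runs the eventual exponent race at `t = 1`.

## Contents (all implications; nothing is credited to the summit)

* `two_le_trdeg_of_approxTypeEvAt` — THE ENGINE: `ApproxTypeEvAt n s a b C` with `a < 1`, `n ≥ 1`,
  `s` `ℚ`-linearly independent (so `s 0 ≠ 0` and `θ` has a transcendental coordinate by
  Hermite–Lindemann) gives `2 ≤ trdeg_ℚ ℚ(s, e^s)` (race compactness at `t = 1`, verbatim the
  argument of `stub_raceAnchored` / `approximationRaceEv_proof` with the PROVED level-one property in
  place of Philippon's `ApproximationProperty`).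
* `trdeg_two_of_evRankThreeUp` (registered sub-goal) — stub 7 gives `trdeg_ℚ ℚ(s, e^s) ≥ 2` at EVERY
  free Khovanskii point of rank `n ≥ 3` (`a < 1/(n−1) ≤ 1/2 < 1`).
* `schanuelTwo_of_evNonLWTwo` (registered sub-goal) — stub 6 gives SCHANUEL'S CONJECTURE ITSELF
  (`trdeg ≥ 2 = n`) at every non-Lindemann–Weierstrass free Khovanskii point of `ℂ²`: at `(1, iπ)`
  this is `e ⊥ π`, at `(log 2, log 3)` it is `log 2 ⊥ log 3`, at `(1, log 2)` it is `e ⊥ log 2`.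
* The anchored log point `s = (1, iπ, log 2)`: `linearIndependent_onePiLogTwo`,
  `isFreeKhovanskii_onePiLogTwo` (system `x₀ − 1 = y₁ + 1 = y₂ − 2 = 0`, exponential Jacobian
  `diag(1, −1, 2)`), and `trdeg_two_ePiLogTwo_of_evRankThreeUp : EvRankThreeUp →
  2 ≤ trdeg_ℚ ℚ(iπ, log 2, e)` — a Lean proof of stub 7 is a Lean proof that two of `e, π, log 2`
  are algebraically independent (open; with Philippon's level-two property it would be all three).
-/

noncomputable section

-- `Summit.Schanuel.Schanuel.…` is the mandated summit/sub-problem namespace (single-conjunct summit), hence: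
set_option linter.dupNamespace false

namespace Summit.Schanuel.Schanuel.Cruxes.KhovanskiiApproxTypeEv.AnchoredReduction

open Summit.Schanuel.Schanuel.Theses.DiophantineDichotomy (ApproximationPropertyDegOne)
open Summit.Schanuel.Schanuel.Cruxes.KhovanskiiApproxType.LwSmallHeight (IsFreeKhovanskii)
open Summit.Schanuel.Schanuel.Theorems
open Complex

/-! ## The engine: eventual type `a < 1` forces transcendence degree `≥ 2` -/

/-- **Level-one race, eventual form.** If `θ = (s, e^s) ∈ ℂ²ⁿ` (`n ≥ 1`, `s` `ℚ`-linearly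
independent) has an EVENTUAL approximation type `(a, b, C)` with degree exponent `a < 1`, then
`trdeg_ℚ ℚ(s, e^s) ≥ 2`.  Otherwise `trdeg ≤ 1` and the PROVED level-one approximation property
`approximationPropertyDegOne_proof` supplies, at ONE fixed scale `Δ` chosen by
`ApproximationRaceEv.race (t := 1)` and every large `Y`, a challenger `(γ, d, H)` with `d ≤ cΔ`,
`log H ≤ cY`, `‖γ − θ‖ ≤ exp(−(Δ log H + dY)/c)`; low heights cannot persist (naive Northcott
`ApproximationRaceEv.finite_roots`; `θ` has the transcendental coordinate `s 0` or `e^{s 0}` by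
Hermite–Lindemann), so `H ≥ H₀(d)` eventually and the measure contradicts the race. [folklore] -/
theorem two_le_trdeg_of_approxTypeEvAt {n : ℕ} {s : Fin n → ℂ} {a b C : ℝ} (hn : 1 ≤ n)
    (hs : LinearIndependent ℚ s) (ha : a < 1) (hAT : ApproxTypeEvAt n s a b C) :
    (2 : Cardinal) ≤ Algebra.trdeg ℚ
      ↥(IntermediateField.adjoin ℚ (Set.range s ∪ Set.range (Complex.exp ∘ s))) := by
  by_contra hlt
  rw [not_le] at hlt
  -- `trdeg ≤ 1`, transported along `range (Sum.elim s (exp ∘ s)) = range s ∪ range (exp ∘ s)`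
  -- (stated for a general set: the `ℚ`-algebra instance carries a proof depending on the set)
  have key : ∀ S : Set ℂ, S = Set.range s ∪ Set.range (Complex.exp ∘ s) →
      Algebra.trdeg ℚ ↥(IntermediateField.adjoin ℚ S) ≤ 1 := by
    rintro S rfl
    have h := ApproximationRace.le_pred_of_lt_natCast (n := 2) (by omega) (by exact_mod_cast hlt)
    simpa using h
  set θ : Fin n ⊕ Fin n → ℂ := Sum.elim s (Complex.exp ∘ s) with hθ
  obtain ⟨c, hc1, hAP'⟩ :=
    approximationPropertyDegOne_proof (Fin n ⊕ Fin n) θ (key _ (Set.Sum.elim_range _ _))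
  obtain ⟨hC, hEv'⟩ := hAT
  choose H₀ hH₀ using hEv'
  have ha' : a < 1 / ((1 : ℕ) : ℝ) := by
    rw [Nat.cast_one, div_one]
    exact ha
  have hcpos : (0 : ℝ) < c := lt_of_lt_of_le one_pos hc1
  -- the race at a fixed scale `Δ`
  obtain ⟨Δ, Y₁, hcΔ, hΔY₁, hrace⟩ :=
    ApproximationRaceEv.race (t := 1) le_rfl hc1 hC ha'
  have hΔpos : 0 < Δ := lt_of_lt_of_le hcpos hcΔ
  -- the degree budget and the height threshold at this scale
  set D₀ : ℕ := ⌊c * Δ⌋₊ with hD₀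
  set Hs : ℕ := (Finset.range (D₀ + 1)).sup H₀ with hHs
  -- the finite set of low points
  set R : Set ℂ := {z : ℂ | ∃ P : Polynomial ℤ, P ≠ 0 ∧ P.natDegree ≤ D₀ ∧
    (∀ k, |P.coeff k| ≤ (Hs : ℤ)) ∧ Polynomial.aeval z P = 0} with hR
  set F : Set (Fin n ⊕ Fin n → ℂ) := Set.pi Set.univ (fun _ => R) with hF
  have hFfin : F.Finite := Set.Finite.pi (fun _ => ApproximationRaceEv.finite_roots D₀ Hs)
  -- `θ ∉ F`: `θ` has a transcendental coordinate (`s 0` or, by Hermite–Lindemann, `e^{s 0}`)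
  have hθF : θ ∉ F := by
    have hs0 : s ⟨0, by omega⟩ ≠ 0 := hs.ne_zero ⟨0, by omega⟩
    have htr : ∃ i, Transcendental ℚ (θ i) := by
      by_cases halg : IsAlgebraic ℚ (s ⟨0, by omega⟩)
      · exact ⟨Sum.inr ⟨0, by omega⟩,
          Literature.NumberTheory.Transcendental.transcendental_exp_holds halg hs0⟩
      · exact ⟨Sum.inl ⟨0, by omega⟩, halg⟩
    obtain ⟨i, hi⟩ := htr
    intro hmem
    obtain ⟨P, hP0, -, -, hz⟩ := hmem i (Set.mem_univ i)
    exact hi (ApproximationRaceEv.isAlgebraic_of_root hP0 hz)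
  -- a ball around `θ` missing `F`
  obtain ⟨ε, hε, hball⟩ := Metric.isOpen_iff.mp hFfin.isClosed.isOpen_compl θ hθF
  -- a large second scale `Y`
  have hevY : ∀ᶠ Y in Filter.atTop, Y₁ ≤ Y ∧ Real.exp (-(Y / c)) < ε := by
    refine (Filter.eventually_ge_atTop Y₁).and ?_
    have h1 : Filter.Tendsto (fun Y : ℝ => -(Y / c)) Filter.atTop Filter.atBot :=
      Filter.tendsto_neg_atTop_atBot.comp (Filter.tendsto_id.atTop_div_const hcpos)
    exact (Real.tendsto_exp_atBot.comp h1).eventually (gt_mem_nhds hε)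
  obtain ⟨Y, hY₁Y, hYε⟩ := hevY.exists
  have hΔY : Δ ≤ Y := hΔY₁.trans hY₁Y
  -- the approximant at scale `(Δ, Y)`
  obtain ⟨γ, d, H, hfin, hpoly, hd, -, hdist⟩ := hAP' Δ Y hcΔ hΔY
  obtain ⟨P, hP0, hPdeg, hPH, hPz⟩ := hpoly (Sum.inl ⟨0, by omega⟩)
  have h1d : 1 ≤ d := ApproximationRace.one_le_of_root hP0 hPdeg hPz
  have h1H : 1 ≤ H := ApproximationRace.one_le_height hP0 hPH
  have hd1 : (1 : ℝ) ≤ d := by exact_mod_cast h1d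
  have hH1 : (1 : ℝ) ≤ H := by exact_mod_cast h1H
  have hL : 0 ≤ Real.log H := Real.log_nonneg hH1
  have hdD₀ : d ≤ D₀ := Nat.le_floor hd
  have hd' : (d : ℝ) ≤ (c * Δ) ^ 1 := by rw [pow_one]; exact hd
  -- `‖γ - θ‖ < ε`, so `γ ∉ F`
  have hγθ : ‖γ - θ‖ < ε := by
    refine lt_of_le_of_lt (hdist.trans (Real.exp_le_exp.mpr ?_)) hYε
    rw [neg_le_neg_iff, div_le_div_iff_of_pos_right hcpos]
    have hY0 : 0 ≤ Y := hΔpos.le.trans hΔY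
    nlinarith [mul_nonneg hL hΔpos.le, mul_le_mul_of_nonneg_right hd1 hY0]
  have hγF : γ ∉ F := by
    refine hball ?_
    rw [Metric.mem_ball, dist_eq_norm]
    exact hγθ
  -- hence the height is past the threshold
  have hHsH : Hs < H := by
    by_contra hle'
    rw [not_lt] at hle'
    refine hγF fun i _ => ?_
    obtain ⟨Q, hQ0, hQdeg, hQH, hQz⟩ := hpoly i
    refine ⟨Q, hQ0, hQdeg.trans hdD₀, fun k => (hQH k).trans ?_, hQz⟩
    exact_mod_cast hle'
  have hH₀H : H₀ d ≤ H := by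
    have : H₀ d ≤ Hs := Finset.le_sup (f := H₀) (Finset.mem_range.mpr (Nat.lt_succ_of_le hdD₀))
    omega
  -- the eventual measure applies
  have hlow := hH₀ d H γ hH₀H hfin hpoly
  have hsand := Real.exp_le_exp.mp (hlow.trans hdist)
  have hineq : Real.log H * Δ + d * Y ≤ c * (C * ((d : ℝ) ^ a * Real.log H + (d : ℝ) ^ b)) := by
    have := neg_le_neg hsand
    rw [neg_neg, neg_neg, div_le_iff₀ hcpos] at this
    linarith
  exact absurd hineq (not_le.mpr (hrace Y hY₁Y d H h1d h1H hd'))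

/-! ## Hardness of the two open stubs -/

/-- **Registered sub-goal `trdeg_two_of_evRankThreeUp` — stub 7 is open-problem grade at EVERY point.**
`EvRankThreeUp` (eventual type `a < 1/(n−1)` at the free Khovanskii points of rank `n ≥ 3`) gives
`trdeg_ℚ ℚ(s, e^s) ≥ 2` at every such point, unconditionally (`a < 1/(n−1) ≤ 1/2 < 1` and the
level-one race `two_le_trdeg_of_approxTypeEvAt`).  At non-Lindemann–Weierstrass points this is an
open problem (see `trdeg_two_ePiLogTwo_of_evRankThreeUp`). [folklore] -/
theorem trdeg_two_of_evRankThreeUp : EvRankThreeUp → ∀ (n : ℕ) (s : Fin n → ℂ), 3 ≤ n →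
    LinearIndependent ℚ s → IsFreeKhovanskii n s →
      (2 : Cardinal) ≤ Algebra.trdeg ℚ
        ↥(IntermediateField.adjoin ℚ (Set.range s ∪ Set.range (Complex.exp ∘ s))) := by
  intro hR n s hn hs hfree
  obtain ⟨a, b, C, ha, hAT⟩ := hR n s hn hs hfree
  have ha1 : a < 1 := by
    refine ha.trans_le ?_
    have h3 : (3 : ℝ) ≤ (n : ℝ) := by exact_mod_cast hn
    rw [div_le_one (by linarith)]
    linarith
  exact two_le_trdeg_of_approxTypeEvAt (by omega) hs ha1 hAT

/-- **Registered sub-goal `schanuelTwo_of_evNonLWTwo` — stub 6 IS Schanuel's conjecture at every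
non-Lindemann–Weierstrass free Khovanskii point of `ℂ²`.**  `EvNonLWTwo` (eventual type `a < 1`
there) gives `trdeg_ℚ ℚ(s₀, s₁, e^{s₀}, e^{s₁}) ≥ 2` — at `(1, iπ)` the algebraic independence of
`e` and `π`, at `(log 2, log 3)` that of `log 2` and `log 3`, at `(1, log 2)` that of `e` and
`log 2`; all open.  Unconditional (level-one race). [folklore] -/
theorem schanuelTwo_of_evNonLWTwo : EvNonLWTwo → ∀ s : Fin 2 → ℂ, LinearIndependent ℚ s →
    IsFreeKhovanskii 2 s → (∃ i, Transcendental ℚ (s i)) →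
      (2 : Cardinal) ≤ Algebra.trdeg ℚ
        ↥(IntermediateField.adjoin ℚ (Set.range s ∪ Set.range (Complex.exp ∘ s))) := by
  intro hN s hs hfree htr
  obtain ⟨a, b, C, ha, hAT⟩ := hN s hs hfree htr
  exact two_le_trdeg_of_approxTypeEvAt (by omega) hs ha hAT

/-! ## The anchored log point `s = (1, iπ, log 2)` -/

/-- `log 2` (as a complex number) is transcendental: `e^{log 2} = 2` is algebraic and `log 2 ≠ 0`
(Hermite–Lindemann, proved in the tree). [folklore] -/
theorem transcendental_logTwo : Transcendental ℚ ((Real.log 2 : ℝ) : ℂ) := by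
  intro halg
  have hne : ((Real.log 2 : ℝ) : ℂ) ≠ 0 := by
    have : Real.log 2 ≠ 0 := (Real.log_pos (by norm_num)).ne'
    exact_mod_cast this
  have htr := Literature.NumberTheory.Transcendental.transcendental_exp_holds halg hne
  apply htr
  have hexp : Complex.exp ((Real.log 2 : ℝ) : ℂ) = (2 : ℂ) := by
    rw [← Complex.ofReal_exp, Real.exp_log (by norm_num)]
    norm_num
  rw [hexp]
  have h2 : IsAlgebraic ℚ (algebraMap ℚ ℂ 2) := isAlgebraic_algebraMap 2
  rwa [map_ofNat] at h2

/-- `1, iπ, log 2` are `ℚ`-linearly independent: a rational relation `p + q·iπ + r·log 2 = 0` has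
imaginary part `qπ = 0`, and then `p + r log 2 = 0` with `log 2` irrational (indeed transcendental).
[folklore] -/
theorem linearIndependent_onePiLogTwo :
    LinearIndependent ℚ ![(1 : ℂ), I * Real.pi, ((Real.log 2 : ℝ) : ℂ)] := by
  rw [Fintype.linearIndependent_iff]
  intro g hg
  simp only [Fin.sum_univ_three, Matrix.cons_val_zero, Matrix.cons_val_one,
    Matrix.cons_val] at hg
  -- imaginary part: `g 1 * π = 0`
  have him := congrArg Complex.im hg
  simp only [Complex.add_im, Complex.zero_im] at him
  have h0 : (g 0 • (1 : ℂ)).im = 0 := by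
    rw [Rat.smul_def]; simp
  have h1 : (g 1 • (I * (Real.pi : ℂ))).im = (g 1 : ℝ) * Real.pi := by
    rw [Rat.smul_def]; simp
  have h2 : (g 2 • ((Real.log 2 : ℝ) : ℂ)).im = 0 := by
    rw [Rat.smul_def, ← Complex.ofReal_ratCast, ← Complex.ofReal_mul, Complex.ofReal_im]
  rw [h0, h1, h2, zero_add, add_zero] at him
  have hg1 : g 1 = 0 := by
    have : ((g 1 : ℚ) : ℝ) = 0 := by
      rcases mul_eq_zero.mp him with h | h
      · exact h
      · exact absurd h Real.pi_ne_zero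
    exact_mod_cast this
  -- real part: `g 0 + g 2 * log 2 = 0`
  have hre := congrArg Complex.re hg
  simp only [Complex.add_re, Complex.zero_re] at hre
  have r0 : (g 0 • (1 : ℂ)).re = (g 0 : ℝ) := by
    rw [Rat.smul_def]; simp
  have r1 : (g 1 • (I * (Real.pi : ℂ))).re = 0 := by
    rw [Rat.smul_def]; simp
  have r2 : (g 2 • ((Real.log 2 : ℝ) : ℂ)).re = (g 2 : ℝ) * Real.log 2 := by
    rw [Rat.smul_def, ← Complex.ofReal_ratCast, ← Complex.ofReal_mul, Complex.ofReal_re]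
  rw [r0, r1, r2, add_zero] at hre
  -- if `g 2 ≠ 0` then `log 2 = -g 0 / g 2` would be rational, hence algebraic
  have hg2 : g 2 = 0 := by
    by_contra h2ne
    have h2ne' : ((g 2 : ℚ) : ℝ) ≠ 0 := by exact_mod_cast h2ne
    have hlog : Real.log 2 = -((g 0 : ℚ) : ℝ) / ((g 2 : ℚ) : ℝ) := by
      field_simp
      linarith
    apply transcendental_logTwo
    rw [hlog]
    have : ((( -((g 0 : ℚ) : ℝ) / ((g 2 : ℚ) : ℝ) : ℝ)) : ℂ) = ((-(g 0) / g 2 : ℚ) : ℂ) := by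
      push_cast
      ring
    rw [this]
    exact isAlgebraic_algebraMap (-(g 0) / g 2 : ℚ)
  have hg0 : g 0 = 0 := by
    have : ((g 0 : ℚ) : ℝ) = 0 := by
      rw [hg2] at hre
      simpa using hre
    exact_mod_cast this
  intro i
  fin_cases i
  · exact hg0
  · exact hg1
  · exact hg2

/-- `s = (1, iπ, log 2)` is a free Khovanskii point of rank `3`: it is a zero of the Khovanskii
system `x₀ − 1 = 0`, `y₁ + 1 = 0`, `y₂ − 2 = 0` (`e^{iπ} = −1`, `e^{log 2} = 2`) whose exponential
Jacobian `(∂gᵢ/∂xⱼ + yⱼ ∂gᵢ/∂yⱼ)` is `diag(1, −1, 2)`, of determinant `−2 ≠ 0`. [folklore] -/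
theorem isFreeKhovanskii_onePiLogTwo :
    IsFreeKhovanskii 3 ![(1 : ℂ), I * Real.pi, ((Real.log 2 : ℝ) : ℂ)] := by
  classical
  have hexp1 : Complex.exp (I * (Real.pi : ℂ)) = -1 := by
    rw [mul_comm]; exact Complex.exp_pi_mul_I
  have hexp2' : Complex.exp (Complex.log 2) = (2 : ℂ) := Complex.exp_log (by norm_num)
  refine ⟨![MvPolynomial.X (Sum.inl 0) - MvPolynomial.C 1,
    MvPolynomial.X (Sum.inr 1) + MvPolynomial.C 1,
    MvPolynomial.X (Sum.inr 2) - MvPolynomial.C 2], ?_, ?_⟩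
  · intro i
    fin_cases i
    · simp
    · simp [hexp1]
    · simp [hexp2']
  · rw [Matrix.det_fin_three]
    simp [Matrix.of_apply, MvPolynomial.pderiv_X, hexp1]

/-- **Stub 7 contains an open problem about `e, π, log 2`.** A proof of `EvRankThreeUp` is a proof
that `trdeg_ℚ ℚ(1, iπ, log 2, e, e^{iπ}, e^{log 2}) = trdeg_ℚ ℚ(e, iπ, log 2) ≥ 2`, i.e. that two of
the three numbers `e, π, log 2` are algebraically independent over `ℚ` — open (no algebraic
independence result is known inside `{e, π, log 2}`; Baker's theorem gives only the
`ℚ̄`-LINEAR independence of `1, iπ, log 2`).  With Philippon's level-two approximation property the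
same race would give all of Schanuel's conjecture at this point (`trdeg = 3`). [folklore] -/
theorem trdeg_two_ePiLogTwo_of_evRankThreeUp (hR : EvRankThreeUp) :
    (2 : Cardinal) ≤ Algebra.trdeg ℚ
      ↥(IntermediateField.adjoin ℚ (Set.range ![(1 : ℂ), I * Real.pi, ((Real.log 2 : ℝ) : ℂ)] ∪
        Set.range (Complex.exp ∘ ![(1 : ℂ), I * Real.pi, ((Real.log 2 : ℝ) : ℂ)]))) :=
  trdeg_two_of_evRankThreeUp hR 3 _ le_rfl linearIndependent_onePiLogTwo
    isFreeKhovanskii_onePiLogTwo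

end Summit.Schanuel.Schanuel.Cruxes.KhovanskiiApproxTypeEv.AnchoredReduction

end
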